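import Summits.QuantumFields.YangMills.Theorems.BalabanUVNodesN08OneStepExcessDensity

/-!
# BalabanUVNodes ∕ N08 — THE HISTORY-EXTENSIVE MASS LETTER, III: WHAT NO RE-LETTERING REMOVES — at the TRIVIAL history print's iterated Radon–Nikodym mass
# dominates the `k`-fold transported reference density, `T_{k−1}⋯T_0 1 ≤ m_k(triv,·)` `dU_k`-a.e.; so EVERY version of `hmass` (uniform, file 15 ∕ III-b; history-extensive,
# files 23–24) IMPLIES the `k`-uniform extensive bound `T_{k−1}⋯T_0 1 ≤ e^{c_m|T₁^{(k)}|}` on the iterated push-forward of Haar under [Balaban1985Averaging] (15) — NECESSITY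

Track A, DAG node N08 = T. Bałaban, CMP **102** (1985) 255–275 [Balaban1985UV3]: (41) p. 266 (the history masses; the trivial history's term = the (47)-term, p. 272
L32–33 «Ω_{k+1} = T_η»: NO characteristic function), (2) p. 256 («ρ_{k+1} = Tρ_k»), Thm 1 (5) p. 257 (bounds extensive in `|T₁^{(k)}|`); [Balaban1985Averaging] (10) + (15)
p. 19.  Cell `pub-ymgap`, width seat `pub-ymgap-dag-n08-w1` (g5), W-SEAT-START-LIST §n08 item 1 successor piece (o20) = file 25; `--supports` K1⁹
`StabilityBRunRowsAtRecordR13SepCoPHV` (stmt-QuantumFields-27364, KEY MAP v2; helper).  Companion of files 23 (`…N08LargeFieldRowZBudget`) ∕ 24 (`…N08SlotOfRecordFromAlphaACMassBoundZAE`): there the printed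
Z-terms pay for the history's PAST LARGE-FIELD fibre volumes; here: what they cannot pay for.

THE POINT.  The trivial history has no large-field region (`|Z_j(triv)| = 0`, `Carriers.ZVol_triv`) and, in the standing range, step weight `1` identically
(`Carriers.stepWeight_triv`); its AC mass is `m_{k+1}(triv) = max 1 (T_k[m_k(triv)])` (`MassesAC.massRecAC_triv_succ`).  Hence, along ANY averaging family with `AvgAC`,
**`ρ_k := T_{k−1}⋯T_0 1` (`Carriers.rhoSeq av 1 k`, a version of the density of the `k`-fold push-forward `(Ū_{k−1}∘⋯∘Ū_0)_*dU_0` w.r.t. `dU_k`) satisfies `ρ_k ≤ m_k(triv,·)`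
`dU_k`-a.e.** (§1, monotonicity of the Radon–Nikodym transport a.e., induction).  Consequently (§2) every a.e. mass letter — file 15's ∕ III-b's uniform «`m_k(h,·) ≤ e^{c_m|T₁^{(k)}|}`»
or files 23–24's history-extensive «`m_k(h,·) ≤ exp(c_m|T₁^{(k)}| + β·Σ_{j<k}|Z_j(h)|)`», read at `h = triv` — IMPLIES **(a)′ «`T_{k−1}⋯T_0 1 ≤ e^{c_m|T₁^{(k)}|}` `dU_k`-a.e., `k ≤ K`»**:
the `k`-UNIFORM extensive sup-bound on the iterated transported reference density is NECESSARY, whatever the budget.  (a)′ is the pure «no-stacking» question of n08-w3 g4's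
`N08-EML-JACOBIAN.md` §4 ∕ §8(b) for HAAR INPUT AND NO WEIGHTS — the cleanest form; files 23–24 show the Z-budget removes everything else that stacks.  §3 states both at print's
averaging `avOfPrint N S` (SU(N), every `N`, every level `k ≤ K`).

WHAT THIS FILE PROVES (kernel; theorems only, 0 def; [folklore] measure theory over the lane's `MassesAC.massRecAC` ∕ `Carriers.rhoSeq`; nothing of the paper asserted).
* §1 `rnTransport_mono_ae` — **the Radon–Nikodym transport is MONOTONE a.e.** under `AvgAC`: `0 ≤ f ≤ᵐ g`, `g` integrable ⇒ `T f ≤ T g` `dV`-a.e. (push-forwards are monotone;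
  `d(·)∕dV` is monotone a.e. — file 16's `rnDeriv_le_of_le_withDensity`; finiteness of the larger derivative); ★ `withDensity_rnTransport_eq_pushDensity` — `(T f)·dV = Ū_*(f·dU)`
  EXACTLY (`0 ≤ f` integrable); `withDensity_rhoSeq_succ` — the measures `ι_k := (T_{k−1}⋯T_0 ρ₀)·dU_k` ARE the iterated push-forwards (`ι_{k+1} = ι_k∘Ū_k⁻¹`), so (a)′ is a
  statement about `(Ū_{k−1}∘⋯∘Ū_0)_*dU_0`; `withDensity_rhoSeq_le_iff` (measure ⟺ a.e. currency);
  `withDensity_rhoSeq_one_eq_of_map_eq` ∕ `rhoSeq_one_ae_eq_one_of_map_eq` (E6′ levelwise ⇒ the iterated push-forward IS `dU_k`: (a)′ with `c_m = 0`) and §1c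
  `withDensity_rhoSeq_one_stdAvg_eq` (the lane's axial family `Carriers.stdAvg`: non-vacuity of the currency); ★★ `rhoSeq_one_le_massRecAC_triv_ae` — **`T_{k−1}⋯T_0 1 ≤ m_k(triv,·)`
  `dU_k`-a.e.** for `k ≤ m + K` ([RegularGaugeGroup G], any `M₁, Rcol, ε_L, ε_S`).
* §2 ★★★ `rhoSeq_one_le_ae_of_massRecAC_triv_le_ae` — any a.e. bound `m_k(triv,·) ≤ B` transfers to `T_{k−1}⋯T_0 1 ≤ B` a.e.; ★★★ `rhoSeq_one_le_exp_ae_of_massBoundZ_triv` — the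
  history-extensive letter at `h = triv` (its budget term VANISHES: `Σ_{j<k}|Z_j(triv)| = 0`) gives **`T_{k−1}⋯T_0 1 ≤ e^{c_m|T₁^{(k)}|}` a.e.** — and so does the uniform letter
  (`…_of_massBound_triv`); `withDensity_rhoSeq_le_smul_of_massBoundZ_triv` — the same in measure currency, `(Ū_{k−1}∘⋯∘Ū_0)_*dU_0 ≤ e^{c}·dU_k`.
* §3 at the [B10] slot's averaging: `rhoSeq_one_le_massRecAC_triv_avOfPrint_ae`, ★★★ `iteratedTransport_le_exp_ae_of_massBoundZ_avOfPrint` — for print's averaging on `SU(N)` the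
  antecedent of file 24 §4 ∕ III-b §2 at the trivial history FORCES «`(T_{k−1}⋯T_0 1)(V) ≤ e^{c_m|T₁^{(k)}|}` for `dU_k`-a.e. `V`, `1 ≤ k ≤ K`» along `TOfPrint`'s class.

* §4 (v1.1) `withDensity_rhoSeq_one_eq_map_iter` — `(T_{k−1}⋯T_0 1)·dU_k = (dU_0)∘(Averaging.iter av k)⁻¹` (the composite averaging of `Setup`); ★★★
  `map_iter_le_smul_of_massBoundZ_triv` ∕ `map_iter_avOfPrint_le_smul_of_massBoundZ` — NECESSITY in composite form: «`(dU_0)∘(Ū_{k−1}∘⋯∘Ū_0)⁻¹ ≤ e^{c_m|T₁^{(k)}|}·dU_k`».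

LOCATED READING (R4⁸) (count-neutral; owners — plan ∕ node00-def ∕ pub-balaban3d ∕ the n08-w3∕w6 analysis lineage — decide).  In the AC lane's bookkeeping (masses = EXACT
transports, `MassesAC`), N08's transport residual has an IRREDUCIBLE CORE: (a)′ = the `k`-uniform, `|T₁^{(k)}|`-extensive a.e. bound on the iterated push-forward of the
reference measure under print's averaging — necessary by this file, and (files 23–24) the ONLY part not payable by the printed Z-terms.  It is intrinsic to the printed form of
Thm 1 (pointwise bounds (5) extensive in the CURRENT lattice) once E6′ fails, not an artefact of a letter.  If (a)′ should FAIL for (15), no mass letter survives and the repair is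
architectural (e.g. a fibre-volume-normalised step `T̃f = Tf ∕ T1`, under which every mass is `≤ 1` for free and the factor `T1` moves into Thm 2's rows) — owners' call; nothing
here decides (a)′.

HONEST FRAMING: count-neutral helper; (a)′ is NOT decided here (neither direction); E6′ neither used nor decided; `PrintedUV3V` NOT proved; N08 NOT discharged; one finite 𝕋⁴
programme at fixed ε, Bałaban AS PRINTED — R4 closes the conditional finite-𝕋⁴ rung `BalabanLadder.UV` only; the Yang–Mills mass gap (Clay) is NOT proved by any of this; nothing
continuum ∕ ℝ⁴ ∕ OS.  No `sorry`, standard axioms.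
-/

noncomputable section

open MeasureTheory
open scoped ENNReal

namespace Summit.QuantumFields.YangMills.BalabanUVNodes.N08TrivialHistoryIteratedTransport

open Literature.MathematicalPhysics.QuantumFieldTheory.Balaban1983to89
open Literature.MathematicalPhysics.QuantumFieldTheory.Balaban1983to89.AveragingRT (rnTransport rnDensity pushDensity rnTransport_nonneg stdAvg)
open Summit.QuantumFields.Balaban3D.Carriers
open Summit.QuantumFields.Balaban3D.Proofs.MassesAC
open Summit.QuantumFields.YangMills.BalabanUVNodes.N08MassesACDominated (rnDeriv_le_of_le_withDensity)

/-! ## §1 Monotonicity of the transport a.e.; the trivial history's mass dominates the iterated transported reference density -/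
section Generic

variable {P : Params} {G : Type} [GaugeGroup G] [MeasurableSpace G] [HaarData G]

/-- **THE RADON–NIKODYM TRANSPORT IS MONOTONE, a.e.**: along an averaging with `AvgAC`, for `0 ≤ f`, `0 ≤ g`, `f ≤ g` `dU`-a.e. and `g` integrable,
`T f ≤ T g` `dV`-a.e. (`T = AveragingRT.rnTransport`: `Ū_*(f dU) ≤ Ū_*(g dU) = (dŪ_*(g dU)∕dV)·dV`, so `dŪ_*(f dU)∕dV ≤ dŪ_*(g dU)∕dV` a.e. by file 16's comparison lemma; `toReal` is
monotone below `∞`, and the larger derivative is a.e. finite because `Ū_*(g dU)` is a finite measure). [cite: Balaban1985Averaging, (10) p.19 (the transformation; bookkeeping)] -/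
theorem rnTransport_mono_ae {j : ℕ} {avg : GaugeField P j G → GaugeField P (j + 1) G} (hac : AvgAC avg) {f g : GaugeField P j G → ℝ}
    (hf0 : ∀ U, 0 ≤ f U) (hg0 : ∀ U, 0 ≤ g U) (hfg : f ≤ᵐ[fieldMeasure P j G] g) (hg : Integrable g (fieldMeasure P j G)) :
    rnTransport avg f ≤ᵐ[fieldMeasure P (j + 1) G] rnTransport avg g := by
  -- both transports are `toReal ∘ rnDeriv` of the push-forwards
  have hTf : ∀ V, rnTransport avg f V = ((pushDensity avg f).rnDeriv (fieldMeasure P (j + 1) G) V).toReal := fun V => by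
    simp only [rnTransport, if_pos hf0]; rfl
  have hTg : ∀ V, rnTransport avg g V = ((pushDensity avg g).rnDeriv (fieldMeasure P (j + 1) G) V).toReal := fun V => by
    simp only [rnTransport, if_pos hg0]; rfl
  -- the push-forwards compare, and the larger one is finite and absolutely continuous
  have hle : pushDensity avg f ≤ pushDensity avg g := by
    unfold pushDensity
    exact Measure.map_mono (withDensity_mono (hfg.mono fun U hU => ENNReal.ofReal_le_ofReal hU)) hac.measurable
  haveI : IsFiniteMeasure ((fieldMeasure P j G).withDensity fun U => ENNReal.ofReal (g U)) :=
    isFiniteMeasure_withDensity_ofReal hg.hasFiniteIntegral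
  haveI : IsFiniteMeasure (pushDensity avg g) := by unfold pushDensity; infer_instance
  have hacg : pushDensity avg g ≪ fieldMeasure P (j + 1) G := by
    have := (withDensity_absolutelyContinuous (fieldMeasure P j G) (fun U => ENNReal.ofReal (g U))).map hac.measurable
    exact this.trans hac.ac
  have hle' : pushDensity avg f ≤ (fieldMeasure P (j + 1) G).withDensity ((pushDensity avg g).rnDeriv (fieldMeasure P (j + 1) G)) := by
    rw [Measure.withDensity_rnDeriv_eq _ _ hacg]; exact hle
  have h1 := rnDeriv_le_of_le_withDensity hle'
  have h2 := Measure.rnDeriv_lt_top (pushDensity avg g) (fieldMeasure P (j + 1) G)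
  filter_upwards [h1, h2] with V hV hlt
  rw [hTf, hTg]
  exact ENNReal.toReal_mono hlt.ne hV

/-- ★ **THE TRANSPORT IS THE PUSH-FORWARD, EXACTLY**: under `AvgAC`, for `0 ≤ f` integrable, `(T f)·dV = Ū_*(f·dU)` as measures (`Ū_*(f·dU) ≪ dV`, its Radon–Nikodym
derivative is a.e. finite, and `ofReal ∘ toReal` fixes finite values; `Measure.withDensity_rnDeriv_eq`). [cite: Balaban1985Averaging, (10) p.19 (the transformation; bookkeeping)] -/
theorem withDensity_rnTransport_eq_pushDensity {k : ℕ} {avg : GaugeField P k G → GaugeField P (k + 1) G} (hac : AvgAC avg)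
    {f : GaugeField P k G → ℝ} (hf0 : ∀ U, 0 ≤ f U) (hf : Integrable f (fieldMeasure P k G)) :
    (fieldMeasure P (k + 1) G).withDensity (fun V => ENNReal.ofReal (rnTransport avg f V)) = pushDensity avg f := by
  haveI : IsFiniteMeasure ((fieldMeasure P k G).withDensity fun U => ENNReal.ofReal (f U)) :=
    isFiniteMeasure_withDensity_ofReal hf.hasFiniteIntegral
  haveI : IsFiniteMeasure (pushDensity avg f) := by unfold pushDensity; infer_instance
  have hacf : pushDensity avg f ≪ fieldMeasure P (k + 1) G := by
    have := (withDensity_absolutelyContinuous (fieldMeasure P k G) (fun U => ENNReal.ofReal (f U))).map hac.measurable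
    exact this.trans hac.ac
  have hT : ∀ V, ENNReal.ofReal (rnTransport avg f V) = ENNReal.ofReal ((pushDensity avg f).rnDeriv (fieldMeasure P (k + 1) G) V).toReal := by
    intro V
    have : rnTransport avg f V = rnDensity avg f V := by simp only [rnTransport, if_pos hf0]
    rw [this]; rfl
  have hae : (fun V => ENNReal.ofReal (rnTransport avg f V)) =ᵐ[fieldMeasure P (k + 1) G] (pushDensity avg f).rnDeriv (fieldMeasure P (k + 1) G) := by
    filter_upwards [Measure.rnDeriv_lt_top (pushDensity avg f) (fieldMeasure P (k + 1) G)] with V hV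
    rw [hT V, ENNReal.ofReal_toReal hV.ne]
  rw [withDensity_congr_ae hae, Measure.withDensity_rnDeriv_eq _ _ hacf]

/-- ★ **THE ITERATED TRANSPORT OF A DENSITY IS THE DENSITY OF THE ITERATED PUSH-FORWARD, level by level**: for `0 ≤ ρ₀` integrable and an `AvgAC` family,
`(T_k⋯T_0 ρ₀)·dU_{k+1} = ((T_{k−1}⋯T_0 ρ₀)·dU_k)∘Ū_k⁻¹` — so the measures `ι_k := (Carriers.rhoSeq av ρ₀ k)·dU_k` satisfy `ι_0 = ρ₀·dU_0`, `ι_{k+1} = ι_k∘Ū_k⁻¹`: they ARE the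
iterated push-forwards of `ρ₀·dU_0` (no definition introduced; (a)′ of §2 is therefore the statement `(Ū_{k−1}∘⋯∘Ū_0)_*dU_0 ≤ e^{c_m|T₁^{(k)}|}·dU_k` about MEASURES).
[cite: Balaban1985UV3, (2) p.256 («ρ_{k+1} = Tρ_k»; bookkeeping); Balaban1985Averaging, (10) p.19] -/
theorem withDensity_rhoSeq_succ (av : ∀ j, Averaging P j G) (hav : ∀ j, AvgAC (av j).avg) {ρ₀ : GaugeField P 0 G → ℝ}
    (h0 : ∀ U, 0 ≤ ρ₀ U) (hρ₀ : Integrable ρ₀ (fieldMeasure P 0 G)) (k : ℕ) :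
    (fieldMeasure P (k + 1) G).withDensity (fun V => ENNReal.ofReal (rhoSeq av ρ₀ (k + 1) V)) =
      ((fieldMeasure P k G).withDensity (fun U => ENNReal.ofReal (rhoSeq av ρ₀ k U))).map (av k).avg := by
  rw [rhoSeq_succ]
  exact withDensity_rnTransport_eq_pushDensity (hav k) (rhoSeq_nonneg av ρ₀ h0 k) (integrable_rhoSeq av ρ₀ hρ₀ k)

/-- **(a)′ IN MEASURE CURRENCY, one direction**: an a.e. bound `T_{k−1}⋯T_0 1 ≤ B` is the measure inequality `ι_k ≤ B·dU_k` for the iterated push-forward `ι_k` of `dU_0`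
(`withDensity_mono`); conversely `ι_k ≤ B·dU_k` gives the a.e. bound back (file 16's `rnDeriv_le_of_le_withDensity` + `rnDeriv_withDensity`). [folklore] -/
theorem withDensity_rhoSeq_le_iff (av : ∀ j, Averaging P j G) (k : ℕ) (B : GaugeField P k G → ℝ≥0∞) :
    (fieldMeasure P k G).withDensity (fun V => ENNReal.ofReal (rhoSeq av (fun _ => (1 : ℝ)) k V)) ≤ (fieldMeasure P k G).withDensity B ↔
      ∀ᵐ V ∂(fieldMeasure P k G), ENNReal.ofReal (rhoSeq av (fun _ => (1 : ℝ)) k V) ≤ B V := by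
  have hmeas : Measurable fun V => ENNReal.ofReal (rhoSeq av (fun _ => (1 : ℝ)) k V) :=
    (measurable_rhoSeq av _ measurable_const k).ennreal_ofReal
  refine ⟨fun hle => ?_, fun hae => withDensity_mono hae⟩
  have h1 := rnDeriv_le_of_le_withDensity hle
  have h2 := Measure.rnDeriv_withDensity (fieldMeasure P k G) hmeas
  filter_upwards [h1, h2] with V hV1 hV2
  rw [← hV2]
  exact hV1

/-- **E6′ ⟹ (a)′ WITH CONSTANT `1`, IN MEASURE CURRENCY** (the consistency check of the currency): if every averaging of the family up to level `k` is HAAR-COMPATIBLE,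
`(dU_j)∘Ū_j⁻¹ = dU_{j+1}` (`j < k`), then the iterated push-forward IS the reference measure, `(T_{k−1}⋯T_0 1)·dU_k = dU_k` — e.g. for the axial ∕ standard family
`Carriers.stdAvg` (`Carriers.stdAvg_map`; §1c below). [cite: Balaban1985Averaging, (13) + (15) p.19 (the printed normalisation; bookkeeping)] -/
theorem withDensity_rhoSeq_one_eq_of_map_eq (av : ∀ j, Averaging P j G) (hav : ∀ j, AvgAC (av j).avg)
    (hH : ∀ j, (fieldMeasure P j G).map (av j).avg = fieldMeasure P (j + 1) G) :
    ∀ k, (fieldMeasure P k G).withDensity (fun V => ENNReal.ofReal (rhoSeq av (fun _ => (1 : ℝ)) k V)) = fieldMeasure P k G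
  | 0 => by
    have : (fun V => ENNReal.ofReal (rhoSeq av (fun _ => (1 : ℝ)) 0 V)) = fun _ => (1 : ℝ≥0∞) := by
      funext V; rw [rhoSeq_zero]; simp
    rw [this, withDensity_const, one_smul]
  | k + 1 => by
    rw [withDensity_rhoSeq_succ av hav (fun _ => zero_le_one) (integrable_const _) k, withDensity_rhoSeq_one_eq_of_map_eq av hav hH k]
    exact hH k

/-- … hence `T_{k−1}⋯T_0 1 = 1` `dU_k`-a.e. under levelwise Haar compatibility. [cite: Balaban1985Averaging, (13) + (15) p.19 (bookkeeping)] -/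
theorem rhoSeq_one_ae_eq_one_of_map_eq (av : ∀ j, Averaging P j G) (hav : ∀ j, AvgAC (av j).avg)
    (hH : ∀ j, (fieldMeasure P j G).map (av j).avg = fieldMeasure P (j + 1) G) (k : ℕ) :
    (fun V => ENNReal.ofReal (rhoSeq av (fun _ => (1 : ℝ)) k V)) =ᵐ[fieldMeasure P k G] fun _ => (1 : ℝ≥0∞) := by
  have hmeas : Measurable fun V => ENNReal.ofReal (rhoSeq av (fun _ => (1 : ℝ)) k V) :=
    (measurable_rhoSeq av _ measurable_const k).ennreal_ofReal
  have h := withDensity_rhoSeq_one_eq_of_map_eq av hav hH k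
  have h2 := Measure.rnDeriv_withDensity (fieldMeasure P k G) hmeas
  rw [h] at h2
  filter_upwards [h2, Measure.rnDeriv_self (fieldMeasure P k G)] with V hV2 hV1
  rw [← hV2, hV1]

/-! ### §1c The axial ∕ standard family: (a)′ with constant `1` -/

/-- **NON-VACUITY OF THE CURRENCY: for the lane's standard (axial) averaging family `Carriers.stdAvg` the iterated push-forward of `dU_0` IS `dU_k`**, every `k` — (a)′ holds
with `c_m = 0` there (Haar compatibility `Carriers.stdAvg_map`). [cite: Balaban1985Averaging, (15) p.19 (the axial factor; bookkeeping)] -/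
theorem withDensity_rhoSeq_one_stdAvg_eq [MeasurableMul₂ G] (k : ℕ) :
    (fieldMeasure P k G).withDensity (fun V => ENNReal.ofReal (rhoSeq (stdAvg P G) (fun _ => (1 : ℝ)) k V)) = fieldMeasure P k G :=
  withDensity_rhoSeq_one_eq_of_map_eq (stdAvg P G) (fun j => avgAC_stdAvg j) (fun j => stdAvg_map j) k

variable [RegularGaugeGroup G] (M₁ : ℕ) (Rcol : ℕ → ℕ) (εL εS : ℕ → ℝ) (av : ∀ j, Averaging P j G) (hav : ∀ j, AvgAC (av j).avg)
include hav

/-- ★★ **AT THE TRIVIAL HISTORY THE AC MASS DOMINATES THE ITERATED TRANSPORTED REFERENCE DENSITY: `T_{k−1}⋯T_0 1 ≤ m_k(triv,·)` `dU_k`-a.e.** for `k ≤ m + K` (the standing range,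
where the trivial history's step weight is `1` identically — `Carriers.stepWeight_triv`: no large-field plaquettes, `Λ_k(triv) = ∅`; print p. 272 L32–33 «Ω_{k+1} = T_η»).
Induction: `m_0 = 1 = ρ_0`; `m_{k+1}(triv) = max 1 (T_k[1·m_k(triv)]) ≥ T_k[m_k(triv)] ≥ T_k[ρ_k] = ρ_{k+1}` a.e. (`rnTransport_mono_ae`, masses integrable — `MassesAC.integrable_massRecAC`).
[cite: Balaban1985UV3, (41) p.266 + (47) p.267 + (2) p.256 (bookkeeping)] -/
theorem rhoSeq_one_le_massRecAC_triv_ae : ∀ k, k ≤ P.m + P.K →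
    rhoSeq av (fun _ => (1 : ℝ)) k ≤ᵐ[fieldMeasure P k G] massRecAC M₁ Rcol εL εS av k (Hist.triv P k)
  | 0, _ => Filter.Eventually.of_forall fun V => by rw [rhoSeq_zero, massRecAC_zero]
  | k + 1, hk => by
    have ih := rhoSeq_one_le_massRecAC_triv_ae k (by omega)
    -- the trivial history's integrand is `m_k(triv)` itself (step weight `1` in the range)
    have hw : (fun U => stepWeight M₁ Rcol εL εS k (Hist.triv P (k + 1)) U * massRecAC M₁ Rcol εL εS av k (Hist.triv P k) U) =
        massRecAC M₁ Rcol εL εS av k (Hist.triv P k) :=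
      funext fun U => by rw [stepWeight_triv M₁ Rcol εL εS (by omega) U, one_mul]
    have hmono := rnTransport_mono_ae (hav k) (fun V => rhoSeq_nonneg av _ (fun _ => zero_le_one) k V)
      (fun V => massRecAC_nonneg M₁ Rcol εL εS av k _ V) ih (integrable_massRecAC M₁ Rcol εL εS av k (Hist.triv P k))
    filter_upwards [hmono] with V hV
    rw [rhoSeq_succ, massRecAC_triv_succ, hw]
    exact hV.trans (le_max_right _ _)

/-! ## §2 Necessity: every a.e. mass letter at the trivial history forces the uniform bound on the iterated transported reference density -/

/-- ★★★ **ANY a.e. BOUND ON THE TRIVIAL HISTORY'S MASS TRANSFERS TO THE ITERATED TRANSPORT OF `1`**: `m_k(triv,·) ≤ B` `dU_k`-a.e. ⇒ `T_{k−1}⋯T_0 1 ≤ B` `dU_k`-a.e.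
(`k ≤ m + K`). [cite: Balaban1985UV3, (41) p.266 + (2) p.256 (bookkeeping)] -/
theorem rhoSeq_one_le_ae_of_massRecAC_triv_le_ae {k : ℕ} (hk : k ≤ P.m + P.K) {B : GaugeField P k G → ℝ}
    (hB : ∀ᵐ V ∂(fieldMeasure P k G), massRecAC M₁ Rcol εL εS av k (Hist.triv P k) V ≤ B V) :
    ∀ᵐ V ∂(fieldMeasure P k G), rhoSeq av (fun _ => (1 : ℝ)) k V ≤ B V := by
  filter_upwards [rhoSeq_one_le_massRecAC_triv_ae M₁ Rcol εL εS av hav k hk, hB] with V h1 h2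
  exact h1.trans h2

/-- ★★★ **NECESSITY OF (a)′ UNDER THE HISTORY-EXTENSIVE LETTER**: if «`m_k(h,·) ≤ exp(c_k + β·Σ_{j<k}|Z_j(h)|)` `dU_k`-a.e.» holds at the trivial history (files 23–24's letter read at
`h = triv`; its budget term vanishes, `|Z_j(triv)| = 0`), then **`T_{k−1}⋯T_0 1 ≤ e^{c_k}` `dU_k`-a.e.** (`k ≤ m + K`; any `β`, any profile `c`). [cite: Balaban1985UV3, (41) p.266 + (5) p.257 (the extensive shape; bookkeeping)] -/
theorem rhoSeq_one_le_exp_ae_of_massBoundZ_triv {k : ℕ} (hk : k ≤ P.m + P.K) (c β : ℝ)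
    (hZ : ∀ᵐ V ∂(fieldMeasure P k G), massRecAC M₁ Rcol εL εS av k (Hist.triv P k) V ≤
      Real.exp (c + β * ∑ j ∈ Finset.range k, (ZVol M₁ Rcol k (Hist.triv P k) j : ℝ))) :
    ∀ᵐ V ∂(fieldMeasure P k G), rhoSeq av (fun _ => (1 : ℝ)) k V ≤ Real.exp c := by
  have h0 : ∑ j ∈ Finset.range k, (ZVol M₁ Rcol k (Hist.triv P k) j : ℝ) = 0 :=
    Finset.sum_eq_zero fun j _ => by rw [ZVol_triv]; simp
  refine rhoSeq_one_le_ae_of_massRecAC_triv_le_ae M₁ Rcol εL εS av hav hk ?_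
  simpa only [h0, mul_zero, add_zero] using hZ

/-- ★★ **NECESSITY OF (a)′ UNDER THE UNIFORM LETTER** (file 15 ∕ III-b): «`m_k(triv,·) ≤ e^{c}` `dU_k`-a.e.» ⇒ `T_{k−1}⋯T_0 1 ≤ e^{c}` `dU_k`-a.e. [cite: Balaban1985UV3, (41) p.266 + (5) p.257 (bookkeeping)] -/
theorem rhoSeq_one_le_exp_ae_of_massBound_triv {k : ℕ} (hk : k ≤ P.m + P.K) (c : ℝ)
    (hm : ∀ᵐ V ∂(fieldMeasure P k G), massRecAC M₁ Rcol εL εS av k (Hist.triv P k) V ≤ Real.exp c) :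
    ∀ᵐ V ∂(fieldMeasure P k G), rhoSeq av (fun _ => (1 : ℝ)) k V ≤ Real.exp c :=
  rhoSeq_one_le_ae_of_massRecAC_triv_le_ae M₁ Rcol εL εS av hav hk hm

/-- ★★ **NECESSITY IN MEASURE CURRENCY**: the history-extensive letter at `h = triv` forces `(Ū_{k−1}∘⋯∘Ū_0)_*dU_0 ≤ e^{c}·dU_k`, i.e. `ι_k ≤ e^{c}·dU_k` for the iterated
push-forward `ι_k = (T_{k−1}⋯T_0 1)·dU_k` of `withDensity_rhoSeq_succ` (`k ≤ m + K`). [cite: Balaban1985UV3, (41) p.266 + (5) p.257 (bookkeeping)] -/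
theorem withDensity_rhoSeq_le_smul_of_massBoundZ_triv {k : ℕ} (hk : k ≤ P.m + P.K) (c β : ℝ)
    (hZ : ∀ᵐ V ∂(fieldMeasure P k G), massRecAC M₁ Rcol εL εS av k (Hist.triv P k) V ≤
      Real.exp (c + β * ∑ j ∈ Finset.range k, (ZVol M₁ Rcol k (Hist.triv P k) j : ℝ))) :
    (fieldMeasure P k G).withDensity (fun V => ENNReal.ofReal (rhoSeq av (fun _ => (1 : ℝ)) k V)) ≤ ENNReal.ofReal (Real.exp c) • fieldMeasure P k G := by
  rw [← withDensity_const]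
  refine withDensity_mono ?_
  filter_upwards [rhoSeq_one_le_exp_ae_of_massBoundZ_triv M₁ Rcol εL εS av hav hk c β hZ] with V hV
  exact ENNReal.ofReal_le_ofReal hV

end Generic

/-! ## §3 At the [B10] slot's averaging -/
section Print

open Literature.MathematicalPhysics.QuantumFieldTheory.Balaban1985CMP102.Setting (Scales)
open Literature.MathematicalPhysics.QuantumFieldTheory.Balaban1983to89.B10RunsOfRecord (avOfPrint)
open Literature.MathematicalPhysics.QuantumFieldTheory.Balaban1983to89.Node00 (SU)
open Summit.QuantumFields.YangMills.BalabanUVNodes.N08Thm2AtRecordBridgeInhabited (avgAC_avOfPrint)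

variable (N : ℕ) [NeZero N] {L : ℕ} (S : Scales L) (M₁ : ℕ) (Rcol : ℕ → ℕ) (εL εS : ℕ → ℝ)

/-- **At print's averaging on `SU(N)`: `T_{k−1}⋯T_0 1 ≤ m_k(triv,·)` `dU_k`-a.e.** for every `k ≤ K` (the `T_j` any versions of (10) along [Balaban1985Averaging] (15) — here the
lane's `rnTransport (avOfPrint N S j).avg`, `AvgAC` by `avgAC_avOfPrint`), every `M₁, Rcol, ε_L, ε_S`. [cite: Balaban1985UV3, (2) p.256 + (41) p.266; Balaban1985Averaging, (15) p.19] -/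
theorem rhoSeq_one_le_massRecAC_triv_avOfPrint_ae {k : ℕ} (hk : k ≤ S.K) :
    rhoSeq (avOfPrint N S) (fun _ => (1 : ℝ)) k ≤ᵐ[fieldMeasure S.P k (SU N)]
      massRecAC M₁ Rcol εL εS (avOfPrint N S) k (Hist.triv S.P k) :=
  rhoSeq_one_le_massRecAC_triv_ae M₁ Rcol εL εS (avOfPrint N S) (avgAC_avOfPrint N L S) k (by show k ≤ S.m + S.K; omega)

/-- ★★★ **NECESSITY AT THE SLOT: the history-extensive (or uniform) a.e. mass letter for print's own masses FORCES the `k`-uniform extensive bound on the iterated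
push-forward of Haar under (15)**: if «`massRecAC M₁ Rcol ε_L ε_S (avOfPrint N S) k h ≤ exp(c_m|T₁^{(k)}| + β·Σ_{j<k}|Z_j(h)|)` `dU_k`-a.e.» holds for the trivial history at level
`k ≤ K`, then `(T_{k−1}⋯T_0 1)(V) ≤ e^{c_m|T₁^{(k)}|}` for `dU_k`-a.e. `V` — statement (a)′ at level `k`. [cite: Balaban1985UV3, (5) p.257 + (41) p.266; Balaban1985Averaging, (15) p.19] -/
theorem iteratedTransport_le_exp_ae_of_massBoundZ_avOfPrint {k : ℕ} (hk : k ≤ S.K) (cm β : ℝ)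
    (hZ : ∀ᵐ V ∂(fieldMeasure S.P k (SU N)), massRecAC M₁ Rcol εL εS (avOfPrint N S) k (Hist.triv S.P k) V ≤
      Real.exp (cm * S.sites k + β * ∑ j ∈ Finset.range k, (ZVol M₁ Rcol k (Hist.triv S.P k) j : ℝ))) :
    ∀ᵐ V ∂(fieldMeasure S.P k (SU N)), rhoSeq (avOfPrint N S) (fun _ => (1 : ℝ)) k V ≤ Real.exp (cm * S.sites k) :=
  rhoSeq_one_le_exp_ae_of_massBoundZ_triv M₁ Rcol εL εS (avOfPrint N S) (avgAC_avOfPrint N L S) (by show k ≤ S.m + S.K; omega) _ β hZ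

/-- ★★ … and the same from the UNIFORM letter of III-b §2 read at the trivial history. [cite: Balaban1985UV3, (5) p.257 + (41) p.266; Balaban1985Averaging, (15) p.19] -/
theorem iteratedTransport_le_exp_ae_of_massBound_avOfPrint {k : ℕ} (hk : k ≤ S.K) (cm : ℝ)
    (hm : ∀ᵐ V ∂(fieldMeasure S.P k (SU N)), massRecAC M₁ Rcol εL εS (avOfPrint N S) k (Hist.triv S.P k) V ≤ Real.exp (cm * S.sites k)) :
    ∀ᵐ V ∂(fieldMeasure S.P k (SU N)), rhoSeq (avOfPrint N S) (fun _ => (1 : ℝ)) k V ≤ Real.exp (cm * S.sites k) :=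
  rhoSeq_one_le_exp_ae_of_massBound_triv M₁ Rcol εL εS (avOfPrint N S) (avgAC_avOfPrint N L S) (by show k ≤ S.m + S.K; omega) _ hm

end Print

/-! ## §4 (v1.1) The iterated push-forward as the law of the composite averaging `Averaging.iter av k` -/
section Iter

variable {P : Params} {G : Type} [GaugeGroup G] [MeasurableSpace G] [HaarData G]

/-- The `k`-fold composite averaging `Ū^{(k)} = Ū_{k−1}∘⋯∘Ū_0` (`Setup`'s `Averaging.iter`) is measurable for an `AvgAC` family. [folklore] -/
theorem measurable_iter (av : ∀ j, Averaging P j G) (hav : ∀ j, AvgAC (av j).avg) : ∀ k, Measurable (Averaging.iter av k)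
  | 0 => measurable_id
  | k + 1 => (hav k).1.comp (measurable_iter av hav k)

/-- ★ **THE ITERATED TRANSPORTED REFERENCE DENSITY IS THE LAW OF THE COMPOSITE AVERAGING**: `(T_{k−1}⋯T_0 1)·dU_k = (dU_0)∘(Ū_{k−1}∘⋯∘Ū_0)⁻¹`, i.e.
`dU_k.withDensity (rhoSeq av 1 k) = (fieldMeasure P 0 G).map (Averaging.iter av k)` (§1b's recursion + `Measure.map_map`).  So (a)′ of §2 is LITERALLY the measure inequality
`(fieldMeasure P 0 G).map (Averaging.iter av k) ≤ e^{c_m|T₁^{(k)}|} • fieldMeasure P k G` — a statement about [Balaban1985Averaging] (15)'s composite averaging and Haar alone.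
[cite: Balaban1985UV3, (2) p.256; Balaban1987RG1, (0.11) p.253 (the composite averaging; bookkeeping)] -/
theorem withDensity_rhoSeq_one_eq_map_iter (av : ∀ j, Averaging P j G) (hav : ∀ j, AvgAC (av j).avg) :
    ∀ k, (fieldMeasure P k G).withDensity (fun V => ENNReal.ofReal (rhoSeq av (fun _ => (1 : ℝ)) k V)) = (fieldMeasure P 0 G).map (Averaging.iter av k)
  | 0 => by
    have : (fun V => ENNReal.ofReal (rhoSeq av (fun _ => (1 : ℝ)) 0 V)) = fun _ => (1 : ℝ≥0∞) := by
      funext V; rw [rhoSeq_zero]; simp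
    rw [this, withDensity_const, one_smul]
    exact (Measure.map_id).symm
  | k + 1 => by
    rw [withDensity_rhoSeq_succ av hav (fun _ => zero_le_one) (integrable_const _) k, withDensity_rhoSeq_one_eq_map_iter av hav k,
      Measure.map_map (hav k).1 (measurable_iter av hav k)]
    rfl

variable [RegularGaugeGroup G] (M₁ : ℕ) (Rcol : ℕ → ℕ) (εL εS : ℕ → ℝ) (av : ∀ j, Averaging P j G) (hav : ∀ j, AvgAC (av j).avg)
include hav

/-- ★★★ **NECESSITY, COMPOSITE-AVERAGING FORM**: the history-extensive (or uniform) a.e. mass letter at the trivial history forces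
`(dU_0)∘(Ū_{k−1}∘⋯∘Ū_0)⁻¹ ≤ e^{c}·dU_k` — the law of the `k`-fold composite averaging of a Haar-distributed fine field is dominated by `e^{c}` times Haar on the coarse
lattice (`k ≤ m + K`). [cite: Balaban1985UV3, (41) p.266 + (5) p.257; Balaban1987RG1, (0.11) p.253 (bookkeeping)] -/
theorem map_iter_le_smul_of_massBoundZ_triv {k : ℕ} (hk : k ≤ P.m + P.K) (c β : ℝ)
    (hZ : ∀ᵐ V ∂(fieldMeasure P k G), massRecAC M₁ Rcol εL εS av k (Hist.triv P k) V ≤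
      Real.exp (c + β * ∑ j ∈ Finset.range k, (ZVol M₁ Rcol k (Hist.triv P k) j : ℝ))) :
    (fieldMeasure P 0 G).map (Averaging.iter av k) ≤ ENNReal.ofReal (Real.exp c) • fieldMeasure P k G := by
  rw [← withDensity_rhoSeq_one_eq_map_iter av hav k]
  exact withDensity_rhoSeq_le_smul_of_massBoundZ_triv M₁ Rcol εL εS av hav hk c β hZ

end Iter

section PrintIter

open Literature.MathematicalPhysics.QuantumFieldTheory.Balaban1985CMP102.Setting (Scales)
open Literature.MathematicalPhysics.QuantumFieldTheory.Balaban1983to89.B10RunsOfRecord (avOfPrint)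
open Literature.MathematicalPhysics.QuantumFieldTheory.Balaban1983to89.Node00 (SU)
open Summit.QuantumFields.YangMills.BalabanUVNodes.N08Thm2AtRecordBridgeInhabited (avgAC_avOfPrint)

variable (N : ℕ) [NeZero N] {L : ℕ} (S : Scales L) (M₁ : ℕ) (Rcol : ℕ → ℕ) (εL εS : ℕ → ℝ)

/-- ★★★ **AT PRINT'S AVERAGING, COMPOSITE FORM**: the a.e. mass letter of file 24 §4 ∕ III-b §2 at the trivial history FORCES, for every `k ≤ K`,
`(dU_0)∘(Ū_{k−1}∘⋯∘Ū_0)⁻¹ ≤ e^{c_m|T₁^{(k)}|}·dU_k` for the composite `Averaging.iter (avOfPrint N S) k` of [Balaban1985Averaging] (15) on `SU(N)` — statement (a)′, verbatim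
about print's averaging and Haar. [cite: Balaban1985UV3, (2) p.256 + (5) p.257 + (41) p.266; Balaban1985Averaging, (15) p.19] -/
theorem map_iter_avOfPrint_le_smul_of_massBoundZ {k : ℕ} (hk : k ≤ S.K) (cm β : ℝ)
    (hZ : ∀ᵐ V ∂(fieldMeasure S.P k (SU N)), massRecAC M₁ Rcol εL εS (avOfPrint N S) k (Hist.triv S.P k) V ≤
      Real.exp (cm * S.sites k + β * ∑ j ∈ Finset.range k, (ZVol M₁ Rcol k (Hist.triv S.P k) j : ℝ))) :
    (fieldMeasure S.P 0 (SU N)).map (Averaging.iter (avOfPrint N S) k) ≤ ENNReal.ofReal (Real.exp (cm * S.sites k)) • fieldMeasure S.P k (SU N) :=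
  map_iter_le_smul_of_massBoundZ_triv M₁ Rcol εL εS (avOfPrint N S) (avgAC_avOfPrint N L S) (by show k ≤ S.m + S.K; omega) _ β hZ

end PrintIter

end Summit.QuantumFields.YangMills.BalabanUVNodes.N08TrivialHistoryIteratedTransport

end
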